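import Literature.NumberTheory.LFunctions.MertensFromChebyshev
import Literature.NumberTheory.LFunctions.ChebyshevSylvesterPrimeWindows
import Mathlib.NumberTheory.SmoothNumbers
import Mathlib.NumberTheory.EulerProduct.Basic
import Mathlib.NumberTheory.ArithmeticFunction.Misc
import HarnessLib

/-!
# Ford's smooth-number sets `𝒞(P,R)` (Ford 2002, §2): explicit lower and upper bounds

Topic `Literature/NumberTheory/LFunctions`.

`𝒞(P,R)` is the set of positive integers `n ≤ P` all of whose prime factors lie in
`(√R, R]` (Ford 2002, §2). We prove versions of Ford's Lemmas 2.2 and 2.3 with the explicit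
prime-sum input of `MertensFromChebyshev` (a Chebyshev–Sylvester `θ`-sandwich) in place of
Rosser–Schoenfeld; the constants change accordingly (see the individual docstrings), the
shape of the statements is Ford's.

## References

* K. Ford, *Vinogradov's integral and bounds for the Riemann zeta function*,
  Proc. London Math. Soc. (3) 85 (2002), 565–633, §2, Lemmas 2.2–2.3. [Ford2002]
-/

noncomputable section

open Real Finset ArithmeticFunction
open scoped Chebyshev ArithmeticFunction.Omega

namespace Literature.NumberTheory.LFunctions
namespace FordSmooth

/-! ## The sets -/

/-- The prime-factor condition: every prime factor of `n` lies in `(√R, R]`. [cite: Ford2002, §2] -/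
def GoodFactors (R : ℝ) (n : ℕ) : Prop := ∀ p ∈ n.primeFactors, Real.sqrt R < p ∧ (p : ℝ) ≤ R

/-- `GoodFactors` is decidable (a bounded quantifier over `primeFactors`). [folklore] -/
instance (R : ℝ) (n : ℕ) : Decidable (GoodFactors R n) := by
  unfold GoodFactors; infer_instance

/-- Ford's `𝒞(P,R)`: the positive integers `n ≤ P` all of whose prime factors lie in `(√R, R]`.
[cite: Ford2002, §2] -/
def smoothSet (P R : ℝ) : Finset ℕ := (Finset.Icc 1 ⌊P⌋₊).filter (GoodFactors R)

/-- `N_d(x,R)`-sets: members of `𝒞(x,R)` with at most `d` prime factors counted with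
multiplicity. [cite: Ford2002, proof of Lemma 2.2] -/
def smoothSetOmega (x R : ℝ) (d : ℕ) : Finset ℕ := (smoothSet x R).filter fun n ↦ Ω n ≤ d

/-- Membership in `𝒞(P,R)`. [folklore] -/
theorem mem_smoothSet {P R : ℝ} {n : ℕ} :
    n ∈ smoothSet P R ↔ 1 ≤ n ∧ (n : ℝ) ≤ P ∧ GoodFactors R n := by
  unfold smoothSet
  rw [mem_filter, Finset.mem_Icc]
  constructor
  · rintro ⟨⟨h1, h2⟩, h3⟩
    refine ⟨h1, ?_, h3⟩
    have hP : 0 ≤ P := by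
      by_contra hP
      push Not at hP
      have : ⌊P⌋₊ = 0 := Nat.floor_of_nonpos hP.le
      omega
    exact (Nat.le_floor_iff hP).1 h2
  · rintro ⟨h1, h2, h3⟩
    exact ⟨⟨h1, Nat.le_floor h2⟩, h3⟩

/-- Membership in the `N_d` sets. [folklore] -/
theorem mem_smoothSetOmega {x R : ℝ} {d n : ℕ} :
    n ∈ smoothSetOmega x R d ↔ n ∈ smoothSet x R ∧ Ω n ≤ d := by
  unfold smoothSetOmega; rw [mem_filter]

/-- `N_d ≤ |𝒞|`. [folklore] -/
theorem card_smoothSetOmega_le (x R : ℝ) (d : ℕ) :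
    (smoothSetOmega x R d).card ≤ (smoothSet x R).card :=
  card_le_card (filter_subset _ _)

/-- Monotonicity of `N_d` in `d`. [folklore] -/
theorem smoothSetOmega_mono {x R : ℝ} {d d' : ℕ} (h : d ≤ d') :
    smoothSetOmega x R d ⊆ smoothSetOmega x R d' := fun n hn ↦ by
  rw [mem_smoothSetOmega] at hn ⊢
  exact ⟨hn.1, hn.2.trans h⟩

/-- The number of distinct prime factors is at most `Ω`. [folklore] -/
theorem card_primeFactors_le_cardFactors (n : ℕ) : n.primeFactors.card ≤ Ω n := by
  rw [cardFactors_apply, Nat.primeFactors]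
  exact List.toFinset_card_le _

/-! ## Double counting: `∑_{p ∈ S} N_d(x/p) ≤ (d+1) N_{d+1}(x)` -/

/-- **Overcounting by the number of prime factors.** If `S` is a set of primes in `(√R, R]`,
then `∑_{p∈S} N_d(x/p, R) ≤ (d+1) · N_{d+1}(x, R)`: the map `(p,n) ↦ pn` hits each `m` at most
`ω(m) ≤ Ω(m) ≤ d+1` times. [cite: Ford2002, proof of Lemma 2.2] -/
theorem sum_card_smoothSetOmega_div_le {x R : ℝ} {d : ℕ} {S : Finset ℕ}
    (hS : ∀ p ∈ S, p.Prime ∧ Real.sqrt R < p ∧ (p : ℝ) ≤ R) :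
    ∑ p ∈ S, (smoothSetOmega (x / p) R d).card ≤ (d + 1) * (smoothSetOmega x R (d + 1)).card := by
  classical
  set T : Finset (Σ _ : ℕ, ℕ) := S.sigma fun p ↦ smoothSetOmega (x / p) R d with hT
  have hcardT : T.card = ∑ p ∈ S, (smoothSetOmega (x / p) R d).card := card_sigma _ _
  set f : (Σ _ : ℕ, ℕ) → ℕ := fun q ↦ q.1 * q.2 with hf
  -- the image lies in `N_{d+1}(x)`
  have himage : T.image f ⊆ smoothSetOmega x R (d + 1) := by
    intro m hm
    rw [Finset.mem_image] at hm
    obtain ⟨⟨p, n⟩, hq, rfl⟩ := hm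
    rw [hT, mem_sigma] at hq
    obtain ⟨hp, hn⟩ := hq
    obtain ⟨hpp, hp1, hp2⟩ := hS p hp
    rw [mem_smoothSetOmega, mem_smoothSet] at hn ⊢
    obtain ⟨⟨hn1, hnx, hng⟩, hnd⟩ := hn
    dsimp only at hn1 hnx hng hnd ⊢
    have hp0 : (0 : ℝ) < p := by exact_mod_cast hpp.pos
    refine ⟨⟨?_, ?_, ?_⟩, ?_⟩
    · change 1 ≤ p * n
      exact one_le_mul hpp.one_lt.le hn1
    · change ((p * n : ℕ) : ℝ) ≤ x
      push_cast
      rw [le_div_iff₀ hp0] at hnx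
      linarith
    · intro q hq
      change q ∈ (p * n).primeFactors at hq
      rw [Nat.primeFactors_mul hpp.ne_zero (by omega), Finset.mem_union, hpp.primeFactors,
        Finset.mem_singleton] at hq
      rcases hq with rfl | hq
      · exact ⟨hp1, hp2⟩
      · exact hng q hq
    · change Ω (p * n) ≤ d + 1
      rw [cardFactors_mul hpp.ne_zero (by omega), cardFactors_apply_prime hpp]
      omega
  -- fibres have at most `d+1` elements
  have hfib : ∀ m ∈ T.image f, (T.filter fun q ↦ f q = m).card ≤ d + 1 := by
    intro m hm
    have hm' := himage hm
    rw [mem_smoothSetOmega, mem_smoothSet] at hm'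
    have hm0 : m ≠ 0 := by have := hm'.1.1; omega
    -- `(p, n) ↦ p` injects the fibre into `m.primeFactors`
    have hinj : (T.filter fun q ↦ f q = m).card ≤ m.primeFactors.card := by
      refine Finset.card_le_card_of_injOn (fun q ↦ q.1) (fun q hq ↦ ?_) ?_
      · rw [mem_coe, mem_filter, hT, mem_sigma] at hq
        obtain ⟨⟨hp, -⟩, hqm⟩ := hq
        have hpp := (hS _ hp).1
        rw [mem_coe, Nat.mem_primeFactors]
        exact ⟨hpp, ⟨q.2, hqm.symm⟩, hm0⟩
      · intro q₁ hq₁ q₂ hq₂ h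
        rw [mem_coe, mem_filter] at hq₁ hq₂
        have hp0 : q₁.1 ≠ 0 := by
          rw [hT, mem_sigma] at hq₁
          exact (hS _ hq₁.1.1).1.ne_zero
        have h' : q₁.1 = q₂.1 := h
        have h2 : q₁.2 = q₂.2 := by
          have e := hq₁.2.trans hq₂.2.symm
          simp only [hf] at e
          rw [← h'] at e
          exact Nat.eq_of_mul_eq_mul_left (Nat.pos_of_ne_zero hp0) e
        exact Sigma.ext h' (heq_of_eq h2)
    exact hinj.trans ((card_primeFactors_le_cardFactors m).trans hm'.2)
  have h1 := Finset.card_le_mul_card_image T (d + 1) hfib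
  rw [hcardT] at h1
  exact h1.trans (Nat.mul_le_mul_left _ (card_le_card himage))

/-! ## Lemma 2.3′: the upper bound for `|𝒞(R^u,R)|` (Rankin's trick) -/

/-- The primes in `(√R, R]`, as a `Finset`. [folklore] -/
def windowPrimes (R : ℝ) : Finset ℕ := (Finset.Ioc ⌊Real.sqrt R⌋₊ ⌊R⌋₊).filter Nat.Prime

/-- Members of `𝒞(P,R)` are `(√R,R]`-factored numbers. [folklore] -/
theorem mem_factoredNumbers_of_mem_smoothSet {P R : ℝ} {n : ℕ}
    (hn : n ∈ smoothSet P R) : n ∈ Nat.factoredNumbers (Finset.Ioc ⌊Real.sqrt R⌋₊ ⌊R⌋₊) := by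
  rw [mem_smoothSet] at hn
  refine Nat.mem_factoredNumbers_of_primeFactors_subset (by omega) fun p hp ↦ ?_
  obtain ⟨h1, h2⟩ := hn.2.2 p hp
  rw [Finset.mem_Ioc]
  exact ⟨(Nat.floor_lt (Real.sqrt_nonneg _)).2 h1, Nat.le_floor h2⟩

/-- **Rankin/Euler-product step.** For `β > 0`,
`∑_{n ∈ 𝒞(P,R)} n^{-β} ≤ ∏_{√R < p ≤ R} (1 - p^{-β})⁻¹`. [cite: Ford2002, proof of Lemma 2.3] -/
theorem sum_rpow_neg_smoothSet_le_prod {P R β : ℝ} (hβ : 0 < β) :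
    ∑ n ∈ smoothSet P R, (n : ℝ) ^ (-β) ≤ ∏ p ∈ windowPrimes R, (1 - (p : ℝ) ^ (-β))⁻¹ := by
  set s : Finset ℕ := Finset.Ioc ⌊Real.sqrt R⌋₊ ⌊R⌋₊ with hs
  let f : ℕ →* ℝ :=
    { toFun := fun n ↦ (n : ℝ) ^ (-β)
      map_one' := by simp
      map_mul' := fun m n ↦ by push_cast; exact Real.mul_rpow (Nat.cast_nonneg _) (Nat.cast_nonneg _) }
  have hf : ∀ n : ℕ, f n = (n : ℝ) ^ (-β) := fun n ↦ rfl
  have h1 : ∀ {p : ℕ}, p.Prime → ‖f p‖ < 1 := by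
    intro p hp
    rw [hf, Real.norm_eq_abs, abs_of_nonneg (Real.rpow_nonneg (Nat.cast_nonneg _) _)]
    exact Real.rpow_lt_one_of_one_lt_of_neg (by exact_mod_cast hp.one_lt) (by linarith)
  obtain ⟨-, hsum⟩ := EulerProduct.summable_and_hasSum_factoredNumbers_prod_filter_prime_geometric h1 s
  have hsum' : HasSum ((Nat.factoredNumbers s).indicator (fun n : ℕ ↦ f n))
      (∏ p ∈ s with p.Prime, (1 - f p)⁻¹) := hasSum_subtype_iff_indicator.1 hsum
  have hle := sum_le_hasSum (smoothSet P R)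
    (fun n _ ↦ Set.indicator_nonneg (fun m _ ↦ by rw [hf]; positivity) n) hsum'
  have heq : ∑ n ∈ smoothSet P R, (Nat.factoredNumbers s).indicator (fun n : ℕ ↦ f n) n
      = ∑ n ∈ smoothSet P R, (n : ℝ) ^ (-β) := by
    refine Finset.sum_congr rfl fun n hn ↦ ?_
    rw [Set.indicator_of_mem (mem_factoredNumbers_of_mem_smoothSet hn), hf]
  rw [heq] at hle
  simpa only [windowPrimes, hf] using hle

/-- `∏ (1 - xᵢ)⁻¹ ≤ exp(∑ (xᵢ + xᵢ²/(1-xᵢ)))` for `0 ≤ xᵢ < 1`. [folklore] -/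
theorem prod_inv_one_sub_le_exp {ι : Type*} (s : Finset ι) (x : ι → ℝ)
    (h1 : ∀ i ∈ s, x i < 1) :
    ∏ i ∈ s, (1 - x i)⁻¹ ≤ Real.exp (∑ i ∈ s, (x i + x i ^ 2 / (1 - x i))) := by
  rw [Real.exp_sum]
  refine Finset.prod_le_prod (fun i hi ↦ inv_nonneg.2 (by linarith [h1 i hi])) fun i hi ↦ ?_
  have hlt := h1 i hi
  have hne : 1 - x i ≠ 0 := by linarith
  have e : (1 - x i)⁻¹ = (x i + x i ^ 2 / (1 - x i)) + 1 := by
    field_simp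
    ring
  rw [e]
  exact Real.add_one_le_exp _

/-- `log 2 < 0.6931472`, hence `1.0722 · log 2 < 0.7432`. [folklore] -/
theorem log_two_mul_bound : 1.0722 * Real.log 2 ≤ 0.74320 := by
  have := Real.log_two_lt_d9
  linarith

/-- `e¹⁰ ≥ 20000`. [folklore] -/
theorem exp_ten_ge : (20000 : ℝ) ≤ Real.exp 10 := by
  have h := Real.exp_one_gt_d9
  have : Real.exp 10 = Real.exp 1 ^ 10 := by rw [← Real.exp_nat_mul]; norm_num
  rw [this]
  have h2 : (2.7182818283 : ℝ) ^ 10 ≤ Real.exp 1 ^ 10 :=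
    pow_le_pow_left₀ (by norm_num) h.le 10
  have h3 : (20000 : ℝ) ≤ (2.7182818283 : ℝ) ^ 10 := by norm_num
  linarith

/-- **Mertens over `(√R, R]`.** For `R ≥ e⁴⁰`: `∑_{√R<p≤R} 1/p ≤ 0.751`.
(Ford, with Rosser–Schoenfeld: `0.713`.) [cite: Ford2002, proof of Lemma 2.3] -/
theorem sum_inv_windowPrimes_le {R : ℝ} (hR : Real.exp 40 ≤ R) :
    ∑ p ∈ windowPrimes R, (1 : ℝ) / p ≤ 0.751 := by
  have hR0 : 0 < R := (Real.exp_pos _).trans_le hR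
  have hsq : Real.exp 20 ≤ Real.sqrt R := by
    rw [show (20 : ℝ) = 40 / 2 by norm_num, Real.exp_half]
    exact Real.sqrt_le_sqrt hR
  have hy : Real.exp 10 ≤ Real.sqrt R := (Real.exp_le_exp.2 (by norm_num)).trans hsq
  have hyx : Real.sqrt R ≤ R := by
    have hR1 : (1 : ℝ) ≤ R := by linarith [Real.add_one_le_exp (40 : ℝ)]
    have h1 : 1 ≤ Real.sqrt R := Real.one_le_sqrt.2 hR1
    calc Real.sqrt R ≤ Real.sqrt R * Real.sqrt R := le_mul_of_one_le_right (Real.sqrt_nonneg _) h1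
      _ = R := Real.mul_self_sqrt (by linarith)
  have h := MertensChebyshev.sum_inv_primes_window_le hy hyx
  rw [windowPrimes]
  refine h.trans ?_
  have hL : 40 ≤ Real.log R := by rw [Real.le_log_iff_exp_le hR0]; exact hR
  have hlsq : Real.log (Real.sqrt R) = Real.log R / 2 := Real.log_sqrt hR0.le
  have hll : Real.log (Real.log R) - Real.log (Real.log (Real.sqrt R)) = Real.log 2 := by
    rw [hlsq, Real.log_div (by linarith) (by norm_num)]
    ring
  rw [hll, hlsq]
  have h1 := log_two_mul_bound
  have h2 : 0.133 / (Real.log R / 2) ≤ 0.00665 := by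
    rw [div_le_iff₀ (by linarith)]
    linarith
  have h3 : 12 / Real.sqrt (Real.sqrt R) ≤ 0.0006 := by
    have : Real.exp 10 ≤ Real.sqrt (Real.sqrt R) := by
      rw [show (10 : ℝ) = 20 / 2 by norm_num, Real.exp_half]
      exact Real.sqrt_le_sqrt hsq
    have h20000 : (20000 : ℝ) ≤ Real.sqrt (Real.sqrt R) := exp_ten_ge.trans this
    rw [div_le_iff₀ (by linarith)]
    linarith
  linarith

/-- `exp 1.0025 ≤ 2.9294`, i.e. `log (2.2/0.751) ≥ 1.0025`. [folklore] -/
theorem exp_10025_le : Real.exp 1.0025 ≤ 2.9294 := by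
  have h1 := Real.exp_one_lt_d9
  have h2 : Real.exp 0.0025 ≤ 1.003 := by
    have := Real.abs_exp_sub_one_sub_id_le (x := 0.0025) (by norm_num)
    have := (abs_le.1 this).2
    nlinarith
  rw [show (1.0025 : ℝ) = 1 + 0.0025 by norm_num, Real.exp_add]
  nlinarith [Real.exp_pos (1 : ℝ), Real.exp_pos (0.0025 : ℝ)]

/-- `e^{20/3} ≥ 667`. [folklore] -/
theorem exp_twenty_thirds_ge : (667 : ℝ) ≤ Real.exp (20 / 3) := by
  have h := Real.exp_one_gt_d9
  have e6 : Real.exp 6 = Real.exp 1 ^ 6 := by rw [← Real.exp_nat_mul]; norm_num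
  have h6 : (2.7182818283 : ℝ) ^ 6 ≤ Real.exp 1 ^ 6 := pow_le_pow_left₀ (by norm_num) h.le 6
  have h403 : (403 : ℝ) ≤ (2.7182818283 : ℝ) ^ 6 := by norm_num
  have e23 : Real.exp (20 / 3) = Real.exp 6 * Real.exp (2 / 3) := by
    rw [← Real.exp_add]; norm_num
  have h23 : (1 : ℝ) + 2 / 3 ≤ Real.exp (2 / 3) := by
    have := Real.add_one_le_exp (2 / 3 : ℝ); linarith
  rw [e23, e6]
  nlinarith [Real.exp_pos (2 / 3 : ℝ)]

/-- Per-prime estimate 1: `p^{-β} ≤ R^{1-β} · (1/p)` for `0 < p ≤ R`, `β ≤ 1`. [folklore] -/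
theorem rpow_neg_le_mul_inv {p R β : ℝ} (hp0 : 0 < p) (hpR : p ≤ R) (hβ1 : β ≤ 1) :
    p ^ (-β) ≤ R ^ (1 - β) * (1 / p) := by
  have e : p ^ (-β) = p ^ (1 - β) * (1 / p) := by
    rw [one_div, ← Real.rpow_neg_one, ← Real.rpow_add hp0]
    congr 1; ring
  rw [e]
  exact mul_le_mul_of_nonneg_right (Real.rpow_le_rpow hp0.le hpR (by linarith)) (by positivity)

/-- Per-prime estimate 2: `p^{-β} ≤ 1/2` for `p ≥ 8`, `β ≥ 2/3`. [folklore] -/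
theorem rpow_neg_le_half {p β : ℝ} (hp8 : 8 ≤ p) (hβ : 2 / 3 ≤ β) : p ^ (-β) ≤ 1 / 2 := by
  have hp1 : (1 : ℝ) ≤ p := by linarith
  have h1 : p ^ (-β) ≤ p ^ (-(2 / 3) : ℝ) := Real.rpow_le_rpow_of_exponent_le hp1 (by linarith)
  refine h1.trans ?_
  have h2 : p ^ (-(2 / 3) : ℝ) ≤ (8 : ℝ) ^ (-(2 / 3) : ℝ) :=
    Real.rpow_le_rpow_of_nonpos (by norm_num) hp8 (by norm_num)
  refine h2.trans ?_
  rw [show (8 : ℝ) = 2 ^ (3 : ℝ) by norm_num, ← Real.rpow_mul (by norm_num)]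
  norm_num

/-- Per-prime estimate 3: `x²/(1-x) ≤ 0.003/p` for `x = p^{-β}`, `p > e²⁰`, `β ≥ 2/3`. [folklore] -/
theorem rpow_neg_sq_div_le {p β : ℝ} (hp : Real.exp 20 < p) (hβ : 2 / 3 ≤ β) :
    (p ^ (-β)) ^ 2 / (1 - p ^ (-β)) ≤ 0.003 * (1 / p) := by
  have hp8 : (8 : ℝ) ≤ p := by linarith [Real.add_one_le_exp (20 : ℝ)]
  have hp0 : 0 < p := by linarith
  have hp1 : (1 : ℝ) ≤ p := by linarith
  have hxs := rpow_neg_le_half hp8 hβ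
  have hx0 : 0 ≤ p ^ (-β) := Real.rpow_nonneg hp0.le _
  have h1 : (p ^ (-β)) ^ 2 / (1 - p ^ (-β)) ≤ 2 * (p ^ (-β)) ^ 2 := by
    rw [div_le_iff₀ (by linarith)]
    nlinarith
  have h2 : (p ^ (-β)) ^ 2 ≤ p ^ (-(1 / 3) : ℝ) * (1 / p) := by
    have e1 : (p ^ (-β)) ^ 2 = p ^ (-(2 * β)) := by
      rw [← Real.rpow_natCast, ← Real.rpow_mul hp0.le]; congr 1; push_cast; ring
    have e2 : p ^ (-(1 / 3) : ℝ) * (1 / p) = p ^ (-(4 / 3) : ℝ) := by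
      have : (1 : ℝ) / p = p ^ (-1 : ℝ) := by rw [Real.rpow_neg_one, one_div]
      rw [this, ← Real.rpow_add hp0]; norm_num
    rw [e1, e2]
    exact Real.rpow_le_rpow_of_exponent_le hp1 (by linarith)
  have h3 : p ^ (-(1 / 3) : ℝ) ≤ 0.0015 := by
    have : p ^ (-(1 / 3) : ℝ) ≤ (Real.exp 20) ^ (-(1 / 3) : ℝ) :=
      Real.rpow_le_rpow_of_nonpos (Real.exp_pos _) hp.le (by norm_num)
    refine this.trans ?_
    rw [← Real.exp_mul, show (20 : ℝ) * -(1 / 3) = -(20 / 3) by ring, Real.exp_neg,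
      inv_le_comm₀ (Real.exp_pos _) (by norm_num)]
    linarith [exp_twenty_thirds_ge]
  have h4 : (0 : ℝ) ≤ 1 / p := by positivity
  calc (p ^ (-β)) ^ 2 / (1 - p ^ (-β)) ≤ 2 * (p ^ (-β)) ^ 2 := h1
    _ ≤ 2 * (p ^ (-(1 / 3) : ℝ) * (1 / p)) := by linarith
    _ ≤ 2 * (0.0015 * (1 / p)) := by nlinarith
    _ = 0.003 * (1 / p) := by ring

/-- **Ford's Lemma 2.3 (θ-sandwich constants).** If `R ≥ e⁴⁰`, `u ≥ 1` and `R ≥ (2u)³` then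
`|𝒞(R^u, R)| ≤ R^u (2.2/u)^u`. (Ford: `R ≥ (2u)³ ≥ 90000` gives `R^u (2/u)^u` using
Rosser–Schoenfeld; here the prime-sum constant `0.713` becomes `0.751`.)
[cite: Ford2002, Lemma 2.3] -/
theorem card_smoothSet_le {R u : ℝ} (hR : Real.exp 40 ≤ R) (hu : 1 ≤ u) (huR : (2 * u) ^ 3 ≤ R) :
    ((smoothSet (R ^ u) R).card : ℝ) ≤ R ^ u * (2.2 / u) ^ u := by
  have hR0 : 0 < R := (Real.exp_pos _).trans_le hR
  have hL : 40 ≤ Real.log R := by rw [Real.le_log_iff_exp_le hR0]; exact hR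
  have hL0 : 0 < Real.log R := by linarith
  have hu0 : 0 < u := by linarith
  -- `a = log (u / 0.751)`, `β = 1 - a / log R`
  have ha0 : 0 < Real.log (u / 0.751) := Real.log_pos (by rw [lt_div_iff₀ (by norm_num)]; linarith)
  have ha3 : Real.log (u / 0.751) ≤ Real.log R / 3 := by
    have h1 : Real.log (u / 0.751) ≤ Real.log (2 * u) := Real.log_le_log (by positivity) (by
      rw [div_le_iff₀ (by norm_num)]; linarith)
    have h2 : Real.log (2 * u) = Real.log ((2 * u) ^ 3) / 3 := by
      rw [Real.log_pow]; ring
    have h3 : Real.log ((2 * u) ^ 3) ≤ Real.log R := Real.log_le_log (by positivity) huR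
    linarith
  obtain ⟨β, hβdef⟩ : ∃ β : ℝ, β = 1 - Real.log (u / 0.751) / Real.log R := ⟨_, rfl⟩
  have hβ1 : β < 1 := by have := div_pos ha0 hL0; linarith
  have hβ23 : 2 / 3 ≤ β := by
    have : Real.log (u / 0.751) / Real.log R ≤ 1 / 3 := by rw [div_le_iff₀ hL0]; linarith
    linarith
  have hβ0 : 0 < β := by linarith
  have haL : (1 - β) * Real.log R = Real.log (u / 0.751) := by rw [hβdef]; field_simp; ring
  have hP0 : 0 < R ^ u := Real.rpow_pos_of_pos hR0 _
  -- Step 1: `|𝒞| ≤ P^β ∑ n^{-β}`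
  have step1 : ((smoothSet (R ^ u) R).card : ℝ)
      ≤ (R ^ u) ^ β * ∑ n ∈ smoothSet (R ^ u) R, (n : ℝ) ^ (-β) := by
    rw [Finset.card_eq_sum_ones, Nat.cast_sum, Finset.mul_sum]
    refine Finset.sum_le_sum fun n hn ↦ ?_
    rw [mem_smoothSet] at hn
    have hn0 : (0 : ℝ) < n := by exact_mod_cast hn.1
    rw [Nat.cast_one, Real.rpow_neg hn0.le, ← div_eq_mul_inv, ← Real.div_rpow hP0.le hn0.le]
    exact Real.one_le_rpow (by rw [le_div_iff₀ hn0]; linarith [hn.2.1]) hβ0.le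
  -- the window primes
  have hSprime : ∀ p ∈ windowPrimes R, p.Prime ∧ Real.sqrt R < p ∧ (p : ℝ) ≤ R := by
    intro p hp
    rw [windowPrimes, mem_filter, Finset.mem_Ioc] at hp
    refine ⟨hp.2, (Nat.floor_lt (Real.sqrt_nonneg _)).1 hp.1.1, ?_⟩
    exact (Nat.le_floor_iff hR0.le).1 hp.1.2
  have hsq : Real.exp 20 ≤ Real.sqrt R := by
    rw [show (20 : ℝ) = 40 / 2 by norm_num, Real.exp_half]
    exact Real.sqrt_le_sqrt hR
  have hp_large : ∀ p ∈ windowPrimes R, Real.exp 20 < (p : ℝ) := fun p hp ↦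
    hsq.trans_lt (hSprime p hp).2.1
  have hx1 : ∀ p ∈ windowPrimes R, (p : ℝ) ^ (-β) < 1 := fun p hp ↦
    (rpow_neg_le_half (by linarith [Real.add_one_le_exp (20 : ℝ), hp_large p hp]) hβ23).trans_lt
      (by norm_num)
  -- Step 2: Euler product and `∏ (1-x)⁻¹ ≤ exp (∑ x + x²/(1-x))`
  have step2 : ∑ n ∈ smoothSet (R ^ u) R, (n : ℝ) ^ (-β)
      ≤ Real.exp (∑ p ∈ windowPrimes R, ((p : ℝ) ^ (-β) + ((p : ℝ) ^ (-β)) ^ 2 / (1 - (p : ℝ) ^ (-β)))) :=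
    (sum_rpow_neg_smoothSet_le_prod hβ0).trans
      (prod_inv_one_sub_le_exp _ (fun p : ℕ ↦ (p : ℝ) ^ (-β)) hx1)
  -- Step 3: `∑ x p ≤ R^{1-β} ∑ 1/p ≤ (u/0.751) · 0.751 = u`
  have hmert := sum_inv_windowPrimes_le hR
  have hR1β : R ^ (1 - β) = u / 0.751 := by
    rw [Real.rpow_def_of_pos hR0, mul_comm, haL, Real.exp_log (by positivity)]
  have step3 : ∑ p ∈ windowPrimes R, (p : ℝ) ^ (-β) ≤ u := by
    have hle : ∀ p ∈ windowPrimes R, (p : ℝ) ^ (-β) ≤ R ^ (1 - β) * (1 / p) := fun p hp ↦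
      rpow_neg_le_mul_inv (by exact_mod_cast (hSprime p hp).1.pos) (hSprime p hp).2.2 hβ1.le
    calc ∑ p ∈ windowPrimes R, (p : ℝ) ^ (-β)
        ≤ ∑ p ∈ windowPrimes R, R ^ (1 - β) * (1 / (p : ℝ)) := sum_le_sum hle
      _ = R ^ (1 - β) * ∑ p ∈ windowPrimes R, (1 : ℝ) / p := by rw [Finset.mul_sum]
      _ ≤ (u / 0.751) * 0.751 := by
          rw [hR1β]; exact mul_le_mul_of_nonneg_left hmert (by positivity)
      _ = u := by field_simp
  -- Step 4: `∑ x²/(1-x) ≤ 0.0025`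
  have step4 : ∑ p ∈ windowPrimes R, ((p : ℝ) ^ (-β)) ^ 2 / (1 - (p : ℝ) ^ (-β)) ≤ 0.0025 := by
    calc ∑ p ∈ windowPrimes R, ((p : ℝ) ^ (-β)) ^ 2 / (1 - (p : ℝ) ^ (-β))
        ≤ ∑ p ∈ windowPrimes R, 0.003 * (1 / (p : ℝ)) :=
          sum_le_sum fun p hp ↦ rpow_neg_sq_div_le (hp_large p hp) hβ23
      _ = 0.003 * ∑ p ∈ windowPrimes R, (1 : ℝ) / p := by rw [Finset.mul_sum]
      _ ≤ 0.003 * 0.751 := by nlinarith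
      _ ≤ 0.0025 := by norm_num
  -- Step 5: assemble in logarithmic form
  have hsum_le : ∑ p ∈ windowPrimes R, ((p : ℝ) ^ (-β) + ((p : ℝ) ^ (-β)) ^ 2 / (1 - (p : ℝ) ^ (-β)))
      ≤ u + 0.0025 := by
    rw [sum_add_distrib]; linarith
  have hcard : ((smoothSet (R ^ u) R).card : ℝ) ≤ (R ^ u) ^ β * Real.exp (u + 0.0025) :=
    step1.trans (mul_le_mul_of_nonneg_left (step2.trans (Real.exp_le_exp.2 hsum_le))
      (Real.rpow_nonneg hP0.le _))
  refine hcard.trans ?_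
  -- everything as exponentials
  have hPexp : R ^ u = Real.exp (u * Real.log R) := by rw [Real.rpow_def_of_pos hR0, mul_comm]
  have hPβ : (R ^ u) ^ β = Real.exp (β * (u * Real.log R)) := by
    rw [hPexp, ← Real.exp_mul, mul_comm]
  have h22 : (2.2 / u) ^ u = Real.exp (u * Real.log (2.2 / u)) := by
    rw [Real.rpow_def_of_pos (by positivity), mul_comm]
  rw [hPβ, ← Real.exp_add, hPexp, h22, ← Real.exp_add, Real.exp_le_exp]
  have hlog22 : Real.log (2.2 / u) = Real.log 2.2 - Real.log u :=
    Real.log_div (by norm_num) hu0.ne'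
  have hloga : Real.log (u / 0.751) = Real.log u - Real.log 0.751 :=
    Real.log_div hu0.ne' (by norm_num)
  have hkey : 1.0025 ≤ Real.log 2.2 - Real.log 0.751 := by
    rw [← Real.log_div (by norm_num) (by norm_num), Real.le_log_iff_exp_le (by norm_num)]
    exact exp_10025_le.trans (by norm_num)
  have e1 : β * (u * Real.log R) = u * Real.log R - u * Real.log (u / 0.751) := by
    rw [hβdef]; field_simp
  rw [e1, hlog22, hloga]
  nlinarith [hkey, hu]


/-! ## Lemma 2.2′: the lower bound for `|𝒞(R^u,R)|`

### Primes in a window and `N_1` -/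

/-- The primes in `(a, b]`. [folklore] -/
def primesIoc (a b : ℝ) : Finset ℕ := (Finset.Ioc ⌊a⌋₊ ⌊b⌋₊).filter Nat.Prime

/-- Membership in `primesIoc`. [folklore] -/
theorem mem_primesIoc {a b : ℝ} {p : ℕ} : p ∈ primesIoc a b ↔ p.Prime ∧ a < p ∧ (p : ℝ) ≤ b := by
  rw [primesIoc, mem_filter, Finset.mem_Ioc]
  constructor
  · rintro ⟨⟨h1, h2⟩, hp⟩
    exact ⟨hp, (Nat.floor_lt' hp.ne_zero).1 h1, (Nat.le_floor_iff' hp.ne_zero).1 h2⟩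
  · rintro ⟨hp, h1, h2⟩
    exact ⟨⟨(Nat.floor_lt' hp.ne_zero).2 h1, (Nat.le_floor_iff' hp.ne_zero).2 h2⟩, hp⟩

/-- Window primes above `√R` and below `R` satisfy the `𝒞`-condition. [folklore] -/
theorem primesIoc_good {R a b : ℝ} (ha : Real.sqrt R ≤ a) (hb : b ≤ R) :
    ∀ p ∈ primesIoc a b, p.Prime ∧ Real.sqrt R < p ∧ (p : ℝ) ≤ R := fun p hp ↦ by
  rw [mem_primesIoc] at hp
  exact ⟨hp.1, ha.trans_lt hp.2.1, hp.2.2.trans hb⟩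

/-- Primes in `(√R, y]` (`y ≤ R`) belong to `N_1(y, R)`. [folklore] -/
theorem primesIoc_subset_smoothSetOmega_one {R y : ℝ} (hyR : y ≤ R) :
    primesIoc (Real.sqrt R) y ⊆ smoothSetOmega y R 1 := by
  intro p hp
  rw [mem_primesIoc] at hp
  obtain ⟨hpp, h1, h2⟩ := hp
  rw [mem_smoothSetOmega, mem_smoothSet]
  refine ⟨⟨hpp.one_lt.le, h2, fun q hq ↦ ?_⟩, (cardFactors_apply_prime hpp).le⟩
  rw [hpp.primeFactors, Finset.mem_singleton] at hq
  subst hq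
  exact ⟨h1, h2.trans hyR⟩

/-- **`N_1` from `θ`.** For `1 ≤ √R ≤ y ≤ R`: `(θ(y) − θ(√R))/log y ≤ N_1(y,R)`.
[cite: Ford2002, proof of Lemma 2.2 (rôle of (2.1))] -/
theorem card_smoothSetOmega_one_ge {R y : ℝ} (hR : 1 ≤ Real.sqrt R) (hy : Real.sqrt R ≤ y)
    (hyR : y ≤ R) : (θ y - θ (Real.sqrt R)) / Real.log y ≤ ((smoothSetOmega y R 1).card : ℝ) := by
  have h1 := Sylvester.theta_sub_theta_le_card_mul_log hR hy
  have h2 : (((Finset.Ioc ⌊Real.sqrt R⌋₊ ⌊y⌋₊).filter Nat.Prime).card : ℝ)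
      ≤ ((smoothSetOmega y R 1).card : ℝ) := by
    exact_mod_cast Finset.card_le_card (primesIoc_subset_smoothSetOmega_one hyR)
  have hy1 : 1 ≤ y := hR.trans hy
  rcases hy1.eq_or_lt with h | h
  · rw [← h, Real.log_one, div_zero]; exact Nat.cast_nonneg _
  · have hlog : 0 < Real.log y := Real.log_pos h
    rw [div_le_iff₀ hlog]
    nlinarith

/-- `θ(y) ≥ (0.9392 − ε) y` as soon as `(9 + 2 log y)√y ≤ ε y`. [folklore] -/
theorem theta_ge_of_sqrt_small {y ε : ℝ} (hy : 1 ≤ y) (h : (9 + 2 * Real.log y) * Real.sqrt y ≤ ε * y) :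
    (0.9392 - ε) * y ≤ θ y := by
  obtain ⟨hθ, -⟩ := theta_bounds_sylvester (x := y) hy
  nlinarith

/-- `exp x ≥ 20000 (x − 9)` for `x ≥ 10`. [folklore] -/
theorem exp_ge_linear {x : ℝ} (hx : 10 ≤ x) : 20000 * (x - 9) ≤ Real.exp x := by
  have h1 : Real.exp x = Real.exp 10 * Real.exp (x - 10) := by rw [← Real.exp_add]; ring_nf
  have h2 : 1 + (x - 10) ≤ Real.exp (x - 10) := by
    have := Real.add_one_le_exp (x - 10); linarith
  rw [h1]
  nlinarith [exp_ten_ge, Real.exp_pos (x - 10), Real.exp_pos (10 : ℝ)]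

/-- `θ(√R) ≤ 1.08 √R` for `R ≥ e⁴⁰`. [folklore] -/
theorem theta_sqrt_le {R : ℝ} (hR : Real.exp 40 ≤ R) : θ (Real.sqrt R) ≤ 1.08 * Real.sqrt R := by
  have hsq : Real.exp 20 ≤ Real.sqrt R := by
    rw [show (20 : ℝ) = 40 / 2 by norm_num, Real.exp_half]; exact Real.sqrt_le_sqrt hR
  have hsq1 : 1 ≤ Real.sqrt R := le_trans (by linarith [Real.add_one_le_exp (20 : ℝ)]) hsq
  obtain ⟨-, hθ⟩ := theta_bounds_sylvester (x := Real.sqrt R) hsq1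
  have h4 : Real.exp 10 ≤ Real.sqrt (Real.sqrt R) := by
    rw [show (10 : ℝ) = 20 / 2 by norm_num, Real.exp_half]; exact Real.sqrt_le_sqrt hsq
  have h20000 : (20000 : ℝ) ≤ Real.sqrt (Real.sqrt R) := exp_ten_ge.trans h4
  have hss : Real.sqrt (Real.sqrt R) * Real.sqrt (Real.sqrt R) = Real.sqrt R :=
    Real.mul_self_sqrt (by linarith)
  nlinarith

/-- `e⁸ ≥ 2980`. [folklore] -/
theorem exp_eight_ge : (2980 : ℝ) ≤ Real.exp 8 := by
  have h := Real.exp_one_gt_d9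
  have e8 : Real.exp 8 = Real.exp 1 ^ 8 := by rw [← Real.exp_nat_mul]; norm_num
  have h8 : (2.7182818283 : ℝ) ^ 8 ≤ Real.exp 1 ^ 8 := pow_le_pow_left₀ (by norm_num) h.le 8
  have : (2980 : ℝ) ≤ (2.7182818283 : ℝ) ^ 8 := by norm_num
  linarith

/-- **`N_1` far from `√R`.** For `R ≥ e⁴⁰` and `R^{0.7} ≤ y ≤ R`: `N_1(y,R) ≥ 0.937 y/log R`.
(Ford: `0.46·2 = 0.92` of `y/log R` via (2.1).) [cite: Ford2002, proof of Lemma 2.2, case d = 2] -/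
theorem card_smoothSetOmega_one_ge_far {R y : ℝ} (hR : Real.exp 40 ≤ R) (hy : R ^ (0.7 : ℝ) ≤ y)
    (hyR : y ≤ R) : 0.937 * y / Real.log R ≤ ((smoothSetOmega y R 1).card : ℝ) := by
  have hR0 : 0 < R := (Real.exp_pos _).trans_le hR
  have hL : 40 ≤ Real.log R := by rw [Real.le_log_iff_exp_le hR0]; exact hR
  have hsqR : Real.sqrt R = R ^ (0.5 : ℝ) := by rw [Real.sqrt_eq_rpow]; norm_num
  have hsq_le : Real.sqrt R ≤ y := by
    refine le_trans ?_ hy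
    rw [hsqR]; exact Real.rpow_le_rpow_of_exponent_le (by linarith [Real.add_one_le_exp (40 : ℝ)]) (by norm_num)
  have hsq1 : 1 ≤ Real.sqrt R := by
    rw [Real.one_le_sqrt]; linarith [Real.add_one_le_exp (40 : ℝ)]
  have hy1 : 1 ≤ y := hsq1.trans hsq_le
  have hy0 : 0 < y := by linarith
  have hbase := card_smoothSetOmega_one_ge hsq1 hsq_le hyR
  refine le_trans ?_ hbase
  -- `θ y ≥ 0.9382 y`
  have hsy : R ^ (0.35 : ℝ) ≤ Real.sqrt y := by
    rw [Real.sqrt_eq_rpow, show (0.35 : ℝ) = 0.7 * (1 / 2) by norm_num, Real.rpow_mul hR0.le]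
    exact Real.rpow_le_rpow (by positivity) hy (by norm_num)
  have hexp : 20000 * (0.35 * Real.log R - 9) ≤ R ^ (0.35 : ℝ) := by
    rw [Real.rpow_def_of_pos hR0, show Real.log R * 0.35 = 0.35 * Real.log R by ring]
    exact exp_ge_linear (by linarith)
  have hlogy : Real.log y ≤ Real.log R := Real.log_le_log hy0 hyR
  have hlogy0 : 0 ≤ Real.log y := Real.log_nonneg hy1
  have hθy : (0.9392 - 0.001) * y ≤ θ y := by
    refine theta_ge_of_sqrt_small hy1 ?_
    have h1 : 9 + 2 * Real.log y ≤ 0.001 * Real.sqrt y := by nlinarith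
    have h2 : Real.sqrt y * Real.sqrt y = y := Real.mul_self_sqrt hy0.le
    nlinarith [Real.sqrt_nonneg y]
  -- `θ √R ≤ 1.08 √R ≤ 0.00037 y`
  have hθs := theta_sqrt_le hR
  have hsmall : Real.sqrt R ≤ y / 2980 := by
    have e : Real.sqrt R = R ^ (0.7 : ℝ) * (R ^ (0.2 : ℝ))⁻¹ := by
      rw [hsqR, ← Real.rpow_neg hR0.le, ← Real.rpow_add hR0]; norm_num
    have h02 : (2980 : ℝ) ≤ R ^ (0.2 : ℝ) := by
      rw [Real.rpow_def_of_pos hR0]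
      refine exp_eight_ge.trans (Real.exp_le_exp.2 ?_)
      nlinarith
    rw [e, ← div_eq_mul_inv, div_le_div_iff₀ (by positivity) (by norm_num)]
    nlinarith [Real.rpow_nonneg hR0.le (0.7 : ℝ)]
  have hnum : 0.937 * y ≤ θ y - θ (Real.sqrt R) := by nlinarith [Real.sqrt_nonneg R]
  -- divide
  rcases hy1.eq_or_lt with h | h
  · -- `y = 1` is impossible since `y ≥ √R ≥ e^{20}`; but handle uniformly
    rw [← h] at hnum
    have : θ 1 - θ (Real.sqrt R) ≤ 0 := by
      rw [Chebyshev.theta_one]; linarith [Chebyshev.theta_nonneg (Real.sqrt R)]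
    linarith
  have hlpos : 0 < Real.log y := Real.log_pos h
  calc 0.937 * y / Real.log R ≤ 0.937 * y / Real.log y :=
        div_le_div_of_nonneg_left (by positivity) hlpos hlogy
    _ ≤ (θ y - θ (Real.sqrt R)) / Real.log y := div_le_div_of_nonneg_right hnum hlpos.le

/-- **`N_1` near `√R`.** For `R ≥ e⁴⁰`, `δ log R ≥ 1.79` and `R^{1/2+δ} ≤ y ≤ R`:
`N_1(y,R) ≥ 0.68 y/log R`. (Ford: `0.61`.) [cite: Ford2002, proof of Lemma 2.2, case d = 3] -/
theorem card_smoothSetOmega_one_ge_near {R y δ : ℝ} (hR : Real.exp 40 ≤ R) (hδ0 : 0 < δ)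
    (hδL : 1.79 ≤ δ * Real.log R) (hy : R ^ (1 / 2 + δ) ≤ y) (hyR : y ≤ R) :
    0.68 * y / Real.log R ≤ ((smoothSetOmega y R 1).card : ℝ) := by
  have hR0 : 0 < R := (Real.exp_pos _).trans_le hR
  have hR1 : 1 ≤ R := by linarith [Real.add_one_le_exp (40 : ℝ)]
  have hL : 40 ≤ Real.log R := by rw [Real.le_log_iff_exp_le hR0]; exact hR
  have hsqR : Real.sqrt R = R ^ (1 / 2 : ℝ) := by rw [Real.sqrt_eq_rpow]
  have hsq_le : Real.sqrt R ≤ y := by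
    refine le_trans ?_ hy
    rw [hsqR]; exact Real.rpow_le_rpow_of_exponent_le hR1 (by linarith)
  have hsq1 : 1 ≤ Real.sqrt R := by rw [Real.one_le_sqrt]; exact hR1
  have hy1 : 1 ≤ y := hsq1.trans hsq_le
  have hy0 : 0 < y := by linarith
  have hbase := card_smoothSetOmega_one_ge hsq1 hsq_le hyR
  refine le_trans ?_ hbase
  -- `θ y ≥ 0.9342 y`
  have hsy : R ^ (1 / 4 : ℝ) ≤ Real.sqrt y := by
    have : R ^ (1 / 4 : ℝ) ≤ R ^ ((1 / 2 + δ) * (1 / 2)) :=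
      Real.rpow_le_rpow_of_exponent_le hR1 (by linarith)
    refine this.trans ?_
    rw [Real.rpow_mul hR0.le, ← Real.sqrt_eq_rpow]
    exact Real.sqrt_le_sqrt hy
  have hexp : 20000 * (1 / 4 * Real.log R - 9) ≤ R ^ (1 / 4 : ℝ) := by
    rw [Real.rpow_def_of_pos hR0, show Real.log R * (1 / 4) = 1 / 4 * Real.log R by ring]
    exact exp_ge_linear (by linarith)
  have hlogy : Real.log y ≤ Real.log R := Real.log_le_log hy0 hyR
  have hlogy0 : 0 ≤ Real.log y := Real.log_nonneg hy1
  have hθy : (0.9392 - 0.005) * y ≤ θ y := by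
    refine theta_ge_of_sqrt_small hy1 ?_
    have h1 : 9 + 2 * Real.log y ≤ 0.005 * Real.sqrt y := by nlinarith
    have h2 : Real.sqrt y * Real.sqrt y = y := Real.mul_self_sqrt hy0.le
    nlinarith [Real.sqrt_nonneg y]
  -- `θ √R ≤ 1.08 √R ≤ 1.08 y / R^δ ≤ 0.2461 y`
  have hθs := theta_sqrt_le hR
  have hRδ : 4.39 ≤ R ^ δ := by
    rw [Real.rpow_def_of_pos hR0, show Real.log R * δ = δ * Real.log R by ring]
    have := Real.quadratic_le_exp_of_nonneg (x := δ * Real.log R) (by positivity)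
    nlinarith
  have hsmall : Real.sqrt R * R ^ δ ≤ y := by
    rw [hsqR, ← Real.rpow_add hR0]; exact hy
  have hnum : 0.68 * y ≤ θ y - θ (Real.sqrt R) := by
    have : 4.39 * Real.sqrt R ≤ y := by nlinarith [Real.sqrt_nonneg R]
    nlinarith [Real.sqrt_nonneg R]
  rcases hy1.eq_or_lt with h | h
  · rw [← h] at hnum
    have : θ 1 - θ (Real.sqrt R) ≤ 0 := by
      rw [Chebyshev.theta_one]; linarith [Chebyshev.theta_nonneg (Real.sqrt R)]
    linarith
  have hlpos : 0 < Real.log y := Real.log_pos h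
  calc 0.68 * y / Real.log R ≤ 0.68 * y / Real.log y :=
        div_le_div_of_nonneg_left (by positivity) hlpos hlogy
    _ ≤ (θ y - θ (Real.sqrt R)) / Real.log y := div_le_div_of_nonneg_right hnum hlpos.le


/-! ### The three prime-sum inputs (from `MertensFromChebyshev`) -/

/-- `R = e^L`, `√R = e^{L/2}`, `√√R = e^{L/4}` bookkeeping: for `R ≥ e⁴⁰`,
`√(R^c) = exp (c · log R / 2)`. [folklore] -/
theorem sqrt_rpow_eq_exp {R c : ℝ} (hR : 0 < R) :
    Real.sqrt (R ^ c) = Real.exp (c * Real.log R / 2) := by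
  rw [Real.rpow_def_of_pos hR, ← Real.exp_half]; ring_nf

/-- **Induction-step prime sum.** For `R ≥ e⁴⁰`, `0 < δ ≤ 1/10`, `δ log R ≥ 1.79`:
`∑_{R^{1-δ} < p ≤ R} 1/p ≥ 0.85 δ`. (Ford, via Rosser–Schoenfeld: `> δ`.)
[cite: Ford2002, proof of Lemma 2.2 (inductive step)] -/
theorem sum_inv_primes_step {R δ : ℝ} (hR : Real.exp 40 ≤ R) (hδ0 : 0 < δ) (hδ : δ ≤ 1 / 10)
    (hδL : 1.79 ≤ δ * Real.log R) :
    0.85 * δ ≤ ∑ p ∈ primesIoc (R ^ (1 - δ)) R, (1 : ℝ) / p := by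
  have hR0 : 0 < R := (Real.exp_pos _).trans_le hR
  have hR1 : 1 ≤ R := by linarith [Real.add_one_le_exp (40 : ℝ)]
  have hL : 40 ≤ Real.log R := by rw [Real.le_log_iff_exp_le hR0]; exact hR
  have hL0 : 0 < Real.log R := by linarith
  have hlogy : Real.log (R ^ (1 - δ)) = (1 - δ) * Real.log R := Real.log_rpow hR0 _
  have hy10 : Real.exp 10 ≤ R ^ (1 - δ) := by
    rw [Real.rpow_def_of_pos hR0]; exact Real.exp_le_exp.2 (by nlinarith)
  have hyx : R ^ (1 - δ) ≤ R := by
    conv_rhs => rw [← Real.rpow_one R]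
    exact Real.rpow_le_rpow_of_exponent_le hR1 (by linarith)
  have h := MertensChebyshev.sum_inv_primes_window_ge hy10 hyx
  rw [primesIoc]
  refine le_trans ?_ h
  rw [hlogy]
  have hll : Real.log (Real.log R) - Real.log ((1 - δ) * Real.log R) = -Real.log (1 - δ) := by
    rw [Real.log_mul (by linarith) hL0.ne']; ring
  rw [hll]
  have h1 : δ ≤ -Real.log (1 - δ) := by
    have := Real.log_le_sub_one_of_pos (show 0 < 1 - δ by linarith); linarith
  have h2 : 0.133 / ((1 - δ) * Real.log R) ≤ 0.083 * δ := by
    rw [div_le_iff₀ (by nlinarith)]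
    have : 0.9 * 1.79 ≤ (1 - δ) * (δ * Real.log R) := by nlinarith
    nlinarith
  have h3 : 12 / Real.sqrt (R ^ (1 - δ)) ≤ 0.0016 * δ := by
    rw [sqrt_rpow_eq_exp hR0]
    have he : Real.exp (0.45 * Real.log R) ≤ Real.exp ((1 - δ) * Real.log R / 2) :=
      Real.exp_le_exp.2 (by nlinarith)
    have hlin := exp_ge_linear (x := 0.45 * Real.log R) (by linarith)
    have h4500 : 4500 * Real.log R ≤ Real.exp ((1 - δ) * Real.log R / 2) := by linarith
    rw [div_le_iff₀ (Real.exp_pos _)]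
    nlinarith
  linarith

/-- **Base-case `d = 2` prime sum.** For `R ≥ e⁴⁰`, `0 < δ ≤ 1/10`, `δ log R ≥ 1.79` and
`R^{1-3δ} ≤ y ≤ R^{1-2δ}`: `∑_{y < p ≤ R} 1/p ≥ 1.76 δ`. (Ford: `≥ 2δ`.)
[cite: Ford2002, proof of Lemma 2.2 (case d = 2)] -/
theorem sum_inv_primes_base2 {R δ y : ℝ} (hR : Real.exp 40 ≤ R) (hδ0 : 0 < δ) (hδ : δ ≤ 1 / 10)
    (hδL : 1.79 ≤ δ * Real.log R) (hy1 : R ^ (1 - 3 * δ) ≤ y) (hy2 : y ≤ R ^ (1 - 2 * δ)) :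
    1.76 * δ ≤ ∑ p ∈ primesIoc y R, (1 : ℝ) / p := by
  have hR0 : 0 < R := (Real.exp_pos _).trans_le hR
  have hR1 : 1 ≤ R := by linarith [Real.add_one_le_exp (40 : ℝ)]
  have hL : 40 ≤ Real.log R := by rw [Real.le_log_iff_exp_le hR0]; exact hR
  have hL0 : 0 < Real.log R := by linarith
  have hy0 : 0 < y := lt_of_lt_of_le (Real.rpow_pos_of_pos hR0 _) hy1
  have hlogy1 : (1 - 3 * δ) * Real.log R ≤ Real.log y := by
    rw [← Real.log_rpow hR0]; exact Real.log_le_log (Real.rpow_pos_of_pos hR0 _) hy1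
  have hlogy2 : Real.log y ≤ (1 - 2 * δ) * Real.log R := by
    rw [← Real.log_rpow hR0]; exact Real.log_le_log hy0 hy2
  have hlogy0 : 0 < Real.log y := by nlinarith
  have hy10 : Real.exp 10 ≤ y := by
    rw [← Real.exp_log hy0]; exact Real.exp_le_exp.2 (by nlinarith)
  have hyx : y ≤ R := by
    refine hy2.trans ?_
    conv_rhs => rw [← Real.rpow_one R]
    exact Real.rpow_le_rpow_of_exponent_le hR1 (by linarith)
  have h := MertensChebyshev.sum_inv_primes_window_ge hy10 hyx
  rw [primesIoc]
  refine le_trans ?_ h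
  have h1 : 2 * δ ≤ Real.log (Real.log R) - Real.log (Real.log y) := by
    have hm : Real.log (Real.log y) ≤ Real.log ((1 - 2 * δ) * Real.log R) :=
      Real.log_le_log hlogy0 hlogy2
    have hs : Real.log ((1 - 2 * δ) * Real.log R) = Real.log (1 - 2 * δ) + Real.log (Real.log R) :=
      Real.log_mul (by linarith) hL0.ne'
    have h2δ : Real.log (1 - 2 * δ) ≤ -(2 * δ) := by
      have := Real.log_le_sub_one_of_pos (show 0 < 1 - 2 * δ by linarith); linarith
    linarith
  have h2 : 0.133 / Real.log y ≤ 0.107 * δ := by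
    rw [div_le_iff₀ hlogy0]
    have : 0.7 * 1.79 ≤ Real.log y * δ := by nlinarith
    nlinarith
  have h3 : 12 / Real.sqrt y ≤ 0.003 * δ := by
    have hsy : Real.exp (0.35 * Real.log R) ≤ Real.sqrt y := by
      refine le_trans ?_ (Real.sqrt_le_sqrt hy1)
      rw [sqrt_rpow_eq_exp hR0]
      exact Real.exp_le_exp.2 (by nlinarith)
    have hlin := exp_ge_linear (x := 0.35 * Real.log R) (by linarith)
    have h2500 : 2500 * Real.log R ≤ Real.sqrt y := by linarith
    rw [div_le_iff₀ (by linarith)]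
    nlinarith
  linarith

/-- **Base-case `d = 3` prime sum.** For `R ≥ e⁴⁰`, `0 < δ`, `δ log R ≥ 1.79`,
`√R ≤ y₁ ≤ y₂` with `log (log y₂ / log y₁) ≥ 1.5 δ`: `∑_{y₁ < p ≤ y₂} 1/p ≥ 1.24 δ`.
(Ford: `≥ log(a₂/a₁) − 1.25δ²`.) [cite: Ford2002, proof of Lemma 2.2 (case d = 3)] -/
theorem sum_inv_primes_base3 {R δ y₁ y₂ : ℝ} (hR : Real.exp 40 ≤ R) (hδ0 : 0 < δ)
    (hδL : 1.79 ≤ δ * Real.log R) (h1 : Real.sqrt R ≤ y₁) (h12 : y₁ ≤ y₂)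
    (hlog : 1.5 * δ ≤ Real.log (Real.log y₂) - Real.log (Real.log y₁)) :
    1.24 * δ ≤ ∑ p ∈ primesIoc y₁ y₂, (1 : ℝ) / p := by
  have hR0 : 0 < R := (Real.exp_pos _).trans_le hR
  have hL : 40 ≤ Real.log R := by rw [Real.le_log_iff_exp_le hR0]; exact hR
  have hsqR : Real.sqrt R = Real.exp (Real.log R / 2) := by
    rw [Real.exp_half, Real.exp_log hR0]
  have he20 : Real.exp 20 ≤ Real.sqrt R := by rw [hsqR]; exact Real.exp_le_exp.2 (by linarith)
  have hy10 : Real.exp 10 ≤ y₁ := le_trans (Real.exp_le_exp.2 (by norm_num)) (he20.trans h1)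
  have hy0 : 0 < y₁ := (Real.exp_pos _).trans_le hy10
  have hlogy1 : Real.log R / 2 ≤ Real.log y₁ := by
    have := Real.log_le_log (Real.exp_pos _) (hsqR ▸ h1 : Real.exp (Real.log R / 2) ≤ y₁)
    rwa [Real.log_exp] at this
  have hlogy0 : 0 < Real.log y₁ := by linarith
  have h := MertensChebyshev.sum_inv_primes_window_ge hy10 h12
  rw [primesIoc]
  refine le_trans ?_ h
  have h2' : 0.133 / Real.log y₁ ≤ 0.149 * δ := by
    rw [div_le_iff₀ hlogy0]
    nlinarith
  have h3 : 12 / Real.sqrt y₁ ≤ 0.014 * δ := by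
    have hsy : Real.exp (Real.log R / 4) ≤ Real.sqrt y₁ := by
      refine le_trans ?_ (Real.sqrt_le_sqrt h1)
      rw [hsqR, ← Real.exp_half]; ring_nf; rfl
    have hlin := exp_ge_linear (x := Real.log R / 4) (by linarith)
    have h500 : 500 * Real.log R ≤ Real.sqrt y₁ := by linarith
    rw [div_le_iff₀ (by linarith)]
    nlinarith
  linarith


/-! ### The induction `(2.2)` -/

/-- Real-valued shorthand for `N_d(x, R)`. [folklore] -/
theorem card_smoothSetOmega_mono {x R : ℝ} {d d' : ℕ} (h : d ≤ d') :
    ((smoothSetOmega x R d).card : ℝ) ≤ ((smoothSetOmega x R d').card : ℝ) := by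
  exact_mod_cast Finset.card_le_card (smoothSetOmega_mono h)

/-- **Base case `d = 2` of (2.2).** For `R^{2-3δ} ≤ x ≤ R^{2-2δ}`:
`N_2(x,R) ≥ (0.85δ/2) · x/log R`. [cite: Ford2002, Lemma 2.2, (2.2) with d = 2] -/
theorem lower_base_two {R δ x : ℝ} (hR : Real.exp 40 ≤ R) (hδ0 : 0 < δ) (hδ : δ ≤ 1 / 10)
    (hδL : 1.79 ≤ δ * Real.log R) (hx1 : R ^ (2 - 3 * δ) ≤ x) (hx2 : x ≤ R ^ (2 - 2 * δ)) :
    0.85 * δ / 2 * x / Real.log R ≤ ((smoothSetOmega x R 2).card : ℝ) := by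
  have hR0 : 0 < R := (Real.exp_pos _).trans_le hR
  have hR1 : 1 ≤ R := by linarith [Real.add_one_le_exp (40 : ℝ)]
  have hL : 40 ≤ Real.log R := by rw [Real.le_log_iff_exp_le hR0]; exact hR
  have hL0 : 0 < Real.log R := by linarith
  have hx0 : 0 < x := lt_of_lt_of_le (Real.rpow_pos_of_pos hR0 _) hx1
  -- the window `(x/R, R]`
  have hy1 : R ^ (1 - 3 * δ) ≤ x / R := by
    rw [le_div_iff₀ hR0, ← Real.rpow_add_one hR0.ne', show (1 - 3 * δ + 1 : ℝ) = 2 - 3 * δ by ring]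
    exact hx1
  have hy2 : x / R ≤ R ^ (1 - 2 * δ) := by
    rw [div_le_iff₀ hR0, ← Real.rpow_add_one hR0.ne', show (1 - 2 * δ + 1 : ℝ) = 2 - 2 * δ by ring]
    exact hx2
  have hsqrt : Real.sqrt R ≤ x / R := by
    refine le_trans ?_ hy1
    rw [Real.sqrt_eq_rpow]; exact Real.rpow_le_rpow_of_exponent_le hR1 (by linarith)
  have hS := primesIoc_good (R := R) (a := x / R) (b := R) hsqrt le_rfl
  have hcount := sum_card_smoothSetOmega_div_le (x := x) (R := R) (d := 1) hS
  have hcountR : (∑ p ∈ primesIoc (x / R) R, ((smoothSetOmega (x / p) R 1).card : ℝ))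
      ≤ 2 * ((smoothSetOmega x R 2).card : ℝ) := by exact_mod_cast hcount
  -- each term is `≥ 0.937 (x/p)/log R`
  have hterm : ∀ p ∈ primesIoc (x / R) R,
      0.937 * x / Real.log R * (1 / (p : ℝ)) ≤ ((smoothSetOmega (x / p) R 1).card : ℝ) := by
    intro p hp
    rw [mem_primesIoc] at hp
    obtain ⟨hpp, hp1, hp2⟩ := hp
    have hp0 : (0 : ℝ) < p := by exact_mod_cast hpp.pos
    have hyR : x / p ≤ R := by
      rw [div_le_iff₀ hp0]; rw [div_lt_iff₀ hR0] at hp1; linarith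
    have hy07 : R ^ (0.7 : ℝ) ≤ x / p := by
      have h1 : R ^ (0.7 : ℝ) ≤ R ^ (1 - 3 * δ) := Real.rpow_le_rpow_of_exponent_le hR1 (by linarith)
      refine h1.trans (hy1.trans ?_)
      exact div_le_div_of_nonneg_left hx0.le hp0 hp2
    have h := card_smoothSetOmega_one_ge_far hR hy07 hyR
    refine le_trans (le_of_eq ?_) h
    field_simp
  have hmert := sum_inv_primes_base2 hR hδ0 hδ hδL hy1 hy2
  have hsum : 0.937 * x / Real.log R * (1.76 * δ)
      ≤ ∑ p ∈ primesIoc (x / R) R, ((smoothSetOmega (x / p) R 1).card : ℝ) := by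
    calc 0.937 * x / Real.log R * (1.76 * δ)
        ≤ 0.937 * x / Real.log R * ∑ p ∈ primesIoc (x / R) R, (1 : ℝ) / p :=
          mul_le_mul_of_nonneg_left hmert (by positivity)
      _ = ∑ p ∈ primesIoc (x / R) R, 0.937 * x / Real.log R * (1 / (p : ℝ)) := by rw [Finset.mul_sum]
      _ ≤ _ := sum_le_sum hterm
  have hxL : 0 ≤ x / Real.log R := by positivity
  have e : 0.85 * δ / 2 * x / Real.log R = (0.85 * δ / 2) * (x / Real.log R) := by ring
  have e2 : 0.937 * x / Real.log R * (1.76 * δ) = (0.937 * 1.76 * δ) * (x / Real.log R) := by ring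
  rw [e2] at hsum
  rw [e]
  nlinarith

/-- The exponent bookkeeping of Ford's case `d = 3`: with `a₁ = max(1/2, (u−1)/2)` and
`a₂ = min(1, (u − 1/2 − δ)/2)` one has `log(a₂/a₁) ≥ 1.5 δ` for `2 − 2δ ≤ u < 3 − 3δ`.
[cite: Ford2002, proof of Lemma 2.2 (the intervals I₁, I₂, I₃)] -/
theorem log_ratio_ge {u δ : ℝ} (hδ0 : 0 < δ) (hδ : δ ≤ 1 / 10) (hu1 : 2 - 2 * δ ≤ u)
    (hu2 : u < 3 - 3 * δ) :
    1.5 * δ ≤ Real.log (min 1 ((u - 1 / 2 - δ) / 2)) - Real.log (max (1 / 2) ((u - 1) / 2)) := by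
  rcases lt_or_ge u 2 with h2 | h2
  · -- `u < 2`: `a₁ = 1/2`, `a₂ = (u - 1/2 - δ)/2`
    rw [max_eq_left (by linarith), min_eq_right (by linarith)]
    have hpos : 0 < (u - 1 / 2 - δ) / 2 := by linarith
    rw [← Real.log_div hpos.ne' (by norm_num)]
    have e : (u - 1 / 2 - δ) / 2 / (1 / 2) = u - 1 / 2 - δ := by ring
    rw [e]
    have h12 : (1.2 : ℝ) ≤ u - 1 / 2 - δ := by linarith
    have hlog : Real.log 1.2 ≤ Real.log (u - 1 / 2 - δ) := Real.log_le_log (by norm_num) h12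
    have h16 := Real.one_sub_inv_le_log_of_pos (show (0 : ℝ) < 1.2 by norm_num)
    nlinarith
  rcases le_or_gt u (2.5 + δ) with h3 | h3
  · -- `2 ≤ u ≤ 2.5 + δ`: `a₁ = (u-1)/2`, `a₂ = (u - 1/2 - δ)/2`
    rw [max_eq_right (by linarith), min_eq_right (by linarith)]
    have hpos1 : 0 < (u - 1) / 2 := by linarith
    have hpos2 : 0 < (u - 1 / 2 - δ) / 2 := by linarith
    rw [← Real.log_div hpos2.ne' hpos1.ne']
    have hratio : (1.25 : ℝ) ≤ (u - 1 / 2 - δ) / 2 / ((u - 1) / 2) := by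
      rw [le_div_iff₀ hpos1]; linarith
    have hlog : Real.log 1.25 ≤ Real.log ((u - 1 / 2 - δ) / 2 / ((u - 1) / 2)) :=
      Real.log_le_log (by norm_num) hratio
    have h16 := Real.one_sub_inv_le_log_of_pos (show (0 : ℝ) < 1.25 by norm_num)
    nlinarith
  · -- `u > 2.5 + δ`: `a₁ = (u-1)/2`, `a₂ = 1`
    rw [max_eq_right (by linarith), min_eq_left (by linarith), Real.log_one]
    have hpos1 : 0 < (u - 1) / 2 := by linarith
    have := Real.log_le_sub_one_of_pos hpos1
    linarith

/-- **Base case `d = 3` of (2.2).** For `R^{2-2δ} ≤ x < R^{3-3δ}`: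
`N_3(x,R) ≥ ((0.85δ)²/6) · x/log R`. [cite: Ford2002, Lemma 2.2, (2.2) with d = 3] -/
theorem lower_base_three {R δ x : ℝ} (hR : Real.exp 40 ≤ R) (hδ0 : 0 < δ) (hδ : δ ≤ 1 / 10)
    (hδL : 1.79 ≤ δ * Real.log R) (hx1 : R ^ (2 - 2 * δ) ≤ x) (hx2 : x < R ^ (3 - 3 * δ)) :
    (0.85 * δ) ^ 2 / 6 * x / Real.log R ≤ ((smoothSetOmega x R 3).card : ℝ) := by
  have hR0 : 0 < R := (Real.exp_pos _).trans_le hR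
  have hR1 : 1 < R := by linarith [Real.add_one_le_exp (40 : ℝ)]
  have hL : 40 ≤ Real.log R := by rw [Real.le_log_iff_exp_le hR0]; exact hR
  have hL0 : 0 < Real.log R := by linarith
  have hx0 : 0 < x := lt_of_lt_of_le (Real.rpow_pos_of_pos hR0 _) hx1
  -- `x = R^u`
  obtain ⟨u, hudef⟩ : ∃ u : ℝ, u = Real.log x / Real.log R := ⟨_, rfl⟩
  have hxu : x = R ^ u := by
    rw [Real.rpow_def_of_pos hR0, hudef, mul_div_cancel₀ _ hL0.ne', Real.exp_log hx0]
  have hu1 : 2 - 2 * δ ≤ u := by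
    have := Real.log_le_log (Real.rpow_pos_of_pos hR0 _) hx1
    rw [Real.log_rpow hR0] at this
    rw [hudef, le_div_iff₀ hL0]; linarith
  have hu2 : u < 3 - 3 * δ := by
    have := Real.log_lt_log hx0 hx2
    rw [Real.log_rpow hR0] at this
    rw [hudef, div_lt_iff₀ hL0]; linarith
  -- exponents `a₁, a₂` and the window `(R^{a₁}, R^{a₂}]`
  obtain ⟨a₁, ha₁⟩ : ∃ a : ℝ, a = max (1 / 2) ((u - 1) / 2) := ⟨_, rfl⟩
  obtain ⟨a₂, ha₂⟩ : ∃ a : ℝ, a = min 1 ((u - 1 / 2 - δ) / 2) := ⟨_, rfl⟩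
  have ha₁h : 1 / 2 ≤ a₁ := by rw [ha₁]; exact le_max_left _ _
  have ha₁u : u - 1 ≤ 2 * a₁ := by
    have := le_max_right (1 / 2) ((u - 1) / 2); rw [← ha₁] at this; linarith
  have ha₂1 : a₂ ≤ 1 := by rw [ha₂]; exact min_le_left _ _
  have ha₂u : 2 * a₂ ≤ u - 1 / 2 - δ := by
    have := min_le_right 1 ((u - 1 / 2 - δ) / 2); rw [← ha₂] at this; linarith
  have ha12 : a₁ ≤ a₂ := by
    rw [ha₁, ha₂, max_le_iff]
    constructor <;> rw [le_min_iff] <;> constructor <;> linarith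
  have ha₁0 : 0 < a₁ := by linarith
  have hy1 : Real.sqrt R ≤ R ^ a₁ := by
    rw [Real.sqrt_eq_rpow]; exact Real.rpow_le_rpow_of_exponent_le hR1.le ha₁h
  have hy12 : R ^ a₁ ≤ R ^ a₂ := Real.rpow_le_rpow_of_exponent_le hR1.le ha12
  have hy2 : R ^ a₂ ≤ R := by
    conv_rhs => rw [← Real.rpow_one R]
    exact Real.rpow_le_rpow_of_exponent_le hR1.le ha₂1
  have hlog : 1.5 * δ ≤ Real.log (Real.log (R ^ a₂)) - Real.log (Real.log (R ^ a₁)) := by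
    rw [Real.log_rpow hR0, Real.log_rpow hR0, Real.log_mul (by linarith) hL0.ne',
      Real.log_mul ha₁0.ne' hL0.ne']
    have := log_ratio_ge hδ0 hδ hu1 hu2
    rw [← ha₁, ← ha₂] at this
    linarith
  have hmert := sum_inv_primes_base3 hR hδ0 hδL hy1 hy12 hlog
  obtain ⟨T, hT⟩ : ∃ T : Finset ℕ, T = primesIoc (R ^ a₁) (R ^ a₂) := ⟨_, rfl⟩
  rw [← hT] at hmert
  have hTgood : ∀ p ∈ T, p.Prime ∧ Real.sqrt R < p ∧ (p : ℝ) ≤ R := by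
    rw [hT]; exact primesIoc_good (R := R) hy1 hy2
  have hTmem : ∀ p ∈ T, p.Prime ∧ R ^ a₁ < p ∧ (p : ℝ) ≤ R ^ a₂ := fun p hp ↦ by
    rwa [hT, mem_primesIoc] at hp
  -- the two power identities used below
  have hpow1 : x ≤ R * (R ^ a₁ * R ^ a₁) := by
    rw [← Real.rpow_add hR0, ← Real.rpow_one_add' hR0.le (by linarith), hxu]
    exact Real.rpow_le_rpow_of_exponent_le hR1.le (by linarith)
  have hpow2 : R ^ (1 / 2 + δ) * (R ^ a₂ * R ^ a₂) ≤ x := by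
    rw [← Real.rpow_add hR0, ← Real.rpow_add hR0, hxu]
    exact Real.rpow_le_rpow_of_exponent_le hR1.le (by linarith)
  have hRa0 : 0 < R ^ a₁ := Real.rpow_pos_of_pos hR0 _
  have hRhalf0 : 0 ≤ R ^ (1 / 2 + δ) := Real.rpow_nonneg hR0.le _
  -- (i) `3 N_3(x) ≥ ∑_{p₁} N_2(x/p₁)`
  have h3 : (∑ p₁ ∈ T, ((smoothSetOmega (x / p₁) R 2).card : ℝ))
      ≤ 3 * ((smoothSetOmega x R 3).card : ℝ) := by
    exact_mod_cast sum_card_smoothSetOmega_div_le (x := x) (R := R) (d := 2) hTgood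
  -- (ii) `2 N_2(x/p₁) ≥ ∑_{p₂} N_1(x/p₁/p₂)`
  have h2 : ∀ p₁ ∈ T, (∑ p₂ ∈ T, ((smoothSetOmega (x / p₁ / p₂) R 1).card : ℝ))
      ≤ 2 * ((smoothSetOmega (x / p₁) R 2).card : ℝ) := fun p₁ _ ↦ by
    exact_mod_cast sum_card_smoothSetOmega_div_le (x := x / p₁) (R := R) (d := 1) hTgood
  -- (iii) `N_1(x/p₁/p₂) ≥ 0.68 (x/p₁/p₂)/log R`
  have h1 : ∀ p₁ ∈ T, ∀ p₂ ∈ T, 0.68 * x / Real.log R * (1 / (p₁ : ℝ)) * (1 / (p₂ : ℝ))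
      ≤ ((smoothSetOmega (x / p₁ / p₂) R 1).card : ℝ) := by
    intro p₁ hp₁ p₂ hp₂
    obtain ⟨hp₁p, hp₁a, hp₁b⟩ := hTmem p₁ hp₁
    obtain ⟨hp₂p, hp₂a, hp₂b⟩ := hTmem p₂ hp₂
    have hp₁0 : (0 : ℝ) < p₁ := by exact_mod_cast hp₁p.pos
    have hp₂0 : (0 : ℝ) < p₂ := by exact_mod_cast hp₂p.pos
    have hyR : x / p₁ / p₂ ≤ R := by
      rw [div_div, div_le_iff₀ (by positivity)]
      have hprod : R ^ a₁ * R ^ a₁ ≤ (p₁ : ℝ) * p₂ :=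
        mul_le_mul hp₁a.le hp₂a.le hRa0.le hp₁0.le
      calc x ≤ R * (R ^ a₁ * R ^ a₁) := hpow1
        _ ≤ R * ((p₁ : ℝ) * p₂) := mul_le_mul_of_nonneg_left hprod hR0.le
    have hylow : R ^ (1 / 2 + δ) ≤ x / p₁ / p₂ := by
      rw [div_div, le_div_iff₀ (by positivity)]
      have hprod : (p₁ : ℝ) * p₂ ≤ R ^ a₂ * R ^ a₂ :=
        mul_le_mul hp₁b hp₂b hp₂0.le (Real.rpow_nonneg hR0.le _)
      calc R ^ (1 / 2 + δ) * ((p₁ : ℝ) * p₂) ≤ R ^ (1 / 2 + δ) * (R ^ a₂ * R ^ a₂) :=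
            mul_le_mul_of_nonneg_left hprod hRhalf0
        _ ≤ x := hpow2
    have h := card_smoothSetOmega_one_ge_near hR hδ0 hδL hylow hyR
    refine le_trans (le_of_eq ?_) h
    field_simp
  -- assemble
  have hinner : ∀ p₁ ∈ T, 0.68 * x / Real.log R * (1 / (p₁ : ℝ)) * (1.24 * δ)
      ≤ 2 * ((smoothSetOmega (x / p₁) R 2).card : ℝ) := by
    intro p₁ hp₁
    refine le_trans ?_ (h2 p₁ hp₁)
    calc 0.68 * x / Real.log R * (1 / (p₁ : ℝ)) * (1.24 * δ)
        ≤ 0.68 * x / Real.log R * (1 / (p₁ : ℝ)) * ∑ p₂ ∈ T, (1 : ℝ) / p₂ :=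
          mul_le_mul_of_nonneg_left hmert (by positivity)
      _ = ∑ p₂ ∈ T, 0.68 * x / Real.log R * (1 / (p₁ : ℝ)) * (1 / (p₂ : ℝ)) := by
          rw [Finset.mul_sum]
      _ ≤ _ := sum_le_sum (h1 p₁ hp₁)
  have houter : 0.68 * x / Real.log R * (1.24 * δ) * (1.24 * δ)
      ≤ 2 * ∑ p₁ ∈ T, ((smoothSetOmega (x / p₁) R 2).card : ℝ) := by
    calc 0.68 * x / Real.log R * (1.24 * δ) * (1.24 * δ)
        ≤ 0.68 * x / Real.log R * (∑ p₁ ∈ T, (1 : ℝ) / p₁) * (1.24 * δ) := by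
          have : 0 ≤ 0.68 * x / Real.log R * (1.24 * δ) := by positivity
          nlinarith
      _ = ∑ p₁ ∈ T, 0.68 * x / Real.log R * (1 / (p₁ : ℝ)) * (1.24 * δ) := by
          rw [Finset.mul_sum, Finset.sum_mul]
      _ ≤ ∑ p₁ ∈ T, 2 * ((smoothSetOmega (x / p₁) R 2).card : ℝ) := sum_le_sum hinner
      _ = 2 * ∑ p₁ ∈ T, ((smoothSetOmega (x / p₁) R 2).card : ℝ) := by rw [Finset.mul_sum]
  have hxL : 0 ≤ x / Real.log R := by positivity
  have e1 : 0.68 * x / Real.log R * (1.24 * δ) * (1.24 * δ) = (0.68 * 1.24 ^ 2) * δ ^ 2 * (x / Real.log R) := by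
    ring
  have e2 : (0.85 * δ) ^ 2 / 6 * x / Real.log R = (0.85 ^ 2 / 6) * δ ^ 2 * (x / Real.log R) := by ring
  rw [e1] at houter
  rw [e2]
  nlinarith [sq_nonneg δ]

/-- **Inductive step of (2.2).** [cite: Ford2002, proof of Lemma 2.2 (inductive step)] -/
theorem lower_step {R δ x : ℝ} {d : ℕ} (hd : 3 ≤ d) (hR : Real.exp 40 ≤ R) (hδ0 : 0 < δ)
    (hδ : δ ≤ 1 / 10) (hδL : 1.79 ≤ δ * Real.log R)
    (IH : ∀ y : ℝ, R ^ (2 - 3 * δ) ≤ y → y < R ^ ((d : ℝ) * (1 - δ)) →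
      (0.85 * δ) ^ (d - 1) / (d.factorial : ℝ) * y / Real.log R ≤ ((smoothSetOmega y R d).card : ℝ))
    (hx1 : R ^ ((d : ℝ) * (1 - δ)) ≤ x) (hx2 : x < R ^ (((d : ℝ) + 1) * (1 - δ))) :
    (0.85 * δ) ^ d / ((d + 1).factorial : ℝ) * x / Real.log R
      ≤ ((smoothSetOmega x R (d + 1)).card : ℝ) := by
  have hR0 : 0 < R := (Real.exp_pos _).trans_le hR
  have hR1 : 1 < R := by linarith [Real.add_one_le_exp (40 : ℝ)]
  have hL : 40 ≤ Real.log R := by rw [Real.le_log_iff_exp_le hR0]; exact hR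
  have hL0 : 0 < Real.log R := by linarith
  have hx0 : 0 < x := lt_of_lt_of_le (Real.rpow_pos_of_pos hR0 _) hx1
  have hd3 : (3 : ℝ) ≤ d := by exact_mod_cast hd
  have hsqrt : Real.sqrt R ≤ R ^ (1 - δ) := by
    rw [Real.sqrt_eq_rpow]; exact Real.rpow_le_rpow_of_exponent_le hR1.le (by linarith)
  have hRR : R ^ (1 - δ) ≤ R := by
    conv_rhs => rw [← Real.rpow_one R]
    exact Real.rpow_le_rpow_of_exponent_le hR1.le (by linarith)
  have hS := primesIoc_good (R := R) hsqrt le_rfl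
  have hcount : (∑ p ∈ primesIoc (R ^ (1 - δ)) R, ((smoothSetOmega (x / p) R d).card : ℝ))
      ≤ (d + 1) * ((smoothSetOmega x R (d + 1)).card : ℝ) := by
    exact_mod_cast sum_card_smoothSetOmega_div_le (x := x) (R := R) (d := d) hS
  set K := (0.85 * δ) ^ (d - 1) / (d.factorial : ℝ) with hK
  have hK0 : 0 ≤ K := by positivity
  have hterm : ∀ p ∈ primesIoc (R ^ (1 - δ)) R,
      K * x / Real.log R * (1 / (p : ℝ)) ≤ ((smoothSetOmega (x / p) R d).card : ℝ) := by
    intro p hp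
    rw [mem_primesIoc] at hp
    obtain ⟨hpp, hp1, hp2⟩ := hp
    have hp0 : (0 : ℝ) < p := by exact_mod_cast hpp.pos
    have hy2 : x / p < R ^ ((d : ℝ) * (1 - δ)) := by
      rw [div_lt_iff₀ hp0]
      have : R ^ (((d : ℝ) + 1) * (1 - δ)) = R ^ ((d : ℝ) * (1 - δ)) * R ^ (1 - δ) := by
        rw [← Real.rpow_add hR0]; ring_nf
      have h0 : 0 < R ^ ((d : ℝ) * (1 - δ)) := Real.rpow_pos_of_pos hR0 _
      nlinarith
    have hy1 : R ^ (2 - 3 * δ) ≤ x / p := by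
      rw [le_div_iff₀ hp0]
      have h1 : R ^ (2 - 3 * δ) * p ≤ R ^ (2 - 3 * δ) * R :=
        mul_le_mul_of_nonneg_left hp2 (Real.rpow_nonneg hR0.le _)
      have h2 : R ^ (2 - 3 * δ) * R = R ^ (3 - 3 * δ) := by
        rw [← Real.rpow_add_one hR0.ne']; ring_nf
      have h3 : R ^ (3 - 3 * δ) ≤ R ^ ((d : ℝ) * (1 - δ)) :=
        Real.rpow_le_rpow_of_exponent_le hR1.le (by nlinarith)
      linarith
    have h := IH (x / p) hy1 hy2
    refine le_trans (le_of_eq ?_) h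
    rw [hK]; field_simp
  have hmert := sum_inv_primes_step hR hδ0 hδ hδL
  have hsum : K * x / Real.log R * (0.85 * δ)
      ≤ ∑ p ∈ primesIoc (R ^ (1 - δ)) R, ((smoothSetOmega (x / p) R d).card : ℝ) := by
    calc K * x / Real.log R * (0.85 * δ)
        ≤ K * x / Real.log R * ∑ p ∈ primesIoc (R ^ (1 - δ)) R, (1 : ℝ) / p :=
          mul_le_mul_of_nonneg_left hmert (by positivity)
      _ = ∑ p ∈ primesIoc (R ^ (1 - δ)) R, K * x / Real.log R * (1 / (p : ℝ)) := by
          rw [Finset.mul_sum]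
      _ ≤ _ := sum_le_sum hterm
  have hd1 : (0 : ℝ) < d + 1 := by positivity
  have e : (0.85 * δ) ^ d / ((d + 1).factorial : ℝ) * x / Real.log R
      = K * x / Real.log R * (0.85 * δ) / (d + 1) := by
    rw [hK, Nat.factorial_succ, Nat.cast_mul]
    have hdpow : (0.85 * δ) ^ d = (0.85 * δ) ^ (d - 1) * (0.85 * δ) := by
      rw [← pow_succ]; congr 1; omega
    rw [hdpow]
    have : (d.factorial : ℝ) ≠ 0 := by positivity
    field_simp
    push_cast
    ring
  rw [e, div_le_iff₀ hd1]
  linarith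

/-- **Ford's (2.2) (θ-sandwich constants).** For `R ≥ e⁴⁰`, `0 < δ ≤ 1/10`, `δ log R ≥ 1.79`,
`d ≥ 2` and `R^{2-3δ} ≤ x < R^{d(1-δ)}`: `N_d(x,R) ≥ (0.85δ)^{d-1}/d! · x/log R`.
(Ford: `δ^{d-1}/d!`.) [cite: Ford2002, Lemma 2.2, (2.2)] -/
theorem lower_induction {R δ : ℝ} (hR : Real.exp 40 ≤ R) (hδ0 : 0 < δ) (hδ : δ ≤ 1 / 10)
    (hδL : 1.79 ≤ δ * Real.log R) (d : ℕ) (hd : 2 ≤ d) :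
    ∀ x : ℝ, R ^ (2 - 3 * δ) ≤ x → x < R ^ ((d : ℝ) * (1 - δ)) →
      (0.85 * δ) ^ (d - 1) / (d.factorial : ℝ) * x / Real.log R
        ≤ ((smoothSetOmega x R d).card : ℝ) := by
  have hR0 : 0 < R := (Real.exp_pos _).trans_le hR
  have hR1 : 1 < R := by linarith [Real.add_one_le_exp (40 : ℝ)]
  have hL : 40 ≤ Real.log R := by rw [Real.le_log_iff_exp_le hR0]; exact hR
  have hL0 : 0 < Real.log R := by linarith
  induction d, hd using Nat.le_induction with
  | base =>
    intro x hx1 hx2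
    have hx2' : x ≤ R ^ (2 - 2 * δ) := by
      have : ((2 : ℕ) : ℝ) * (1 - δ) = 2 - 2 * δ := by push_cast; ring
      rw [this] at hx2; exact hx2.le
    have := lower_base_two hR hδ0 hδ hδL hx1 hx2'
    convert this using 1
    norm_num [Nat.factorial]
  | succ d hd IH =>
    intro x hx1 hx2
    have hx0 : 0 < x := lt_of_lt_of_le (Real.rpow_pos_of_pos hR0 _) hx1
    have hxL : 0 ≤ x / Real.log R := by positivity
    rcases lt_or_ge x (R ^ ((d : ℝ) * (1 - δ))) with hlt | hge
    · -- below the previous range: monotonicity in `d`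
      have h1 := IH x hx1 hlt
      have h2 := card_smoothSetOmega_mono (x := x) (R := R) (Nat.le_succ d)
      refine le_trans ?_ (h1.trans h2)
      have hfac : ((d + 1).factorial : ℝ) = (d + 1) * (d.factorial : ℝ) := by
        rw [Nat.factorial_succ]; push_cast; ring
      have hpow : (0.85 * δ) ^ (d + 1 - 1) = (0.85 * δ) ^ (d - 1) * (0.85 * δ) := by
        rw [← pow_succ]; congr 1; omega
      rw [hfac, hpow]
      have hdf : (0 : ℝ) < d.factorial := by positivity
      have hd1 : (1 : ℝ) ≤ d + 1 := by linarith [(Nat.cast_nonneg d : (0 : ℝ) ≤ d)]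
      have hsmall : 0.85 * δ / ((d : ℝ) + 1) ≤ 1 := by
        rw [div_le_one (by linarith)]; linarith
      have e1 : (0.85 * δ) ^ (d - 1) * (0.85 * δ) / ((d + 1 : ℝ) * d.factorial) * x / Real.log R
          = (0.85 * δ / ((d : ℝ) + 1)) * ((0.85 * δ) ^ (d - 1) / d.factorial * (x / Real.log R)) := by
        field_simp
      have e2 : (0.85 * δ) ^ (d - 1) / (d.factorial : ℝ) * x / Real.log R
          = (0.85 * δ) ^ (d - 1) / d.factorial * (x / Real.log R) := by ring
      rw [e1, e2]
      have hnn : 0 ≤ (0.85 * δ) ^ (d - 1) / d.factorial * (x / Real.log R) := by positivity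
      exact mul_le_of_le_one_left hnn hsmall
    · rcases Nat.lt_or_ge d 3 with hd3 | hd3
      · -- `d = 2`: the base case `d = 3`
        have hd2 : d = 2 := by omega
        subst hd2
        have hx1' : R ^ (2 - 2 * δ) ≤ x := by
          have : ((2 : ℕ) : ℝ) * (1 - δ) = 2 - 2 * δ := by push_cast; ring
          rwa [this] at hge
        have hx2' : x < R ^ (3 - 3 * δ) := by
          convert hx2 using 2; push_cast; ring
        have := lower_base_three hR hδ0 hδ hδL hx1' hx2'
        convert this using 1
        norm_num [Nat.factorial]
      · have hx2' : x < R ^ (((d : ℝ) + 1) * (1 - δ)) := by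
          have : (((d + 1 : ℕ) : ℝ)) = (d : ℝ) + 1 := by push_cast; ring
          rwa [this] at hx2
        have := lower_step hd3 hR hδ0 hδ hδL IH hge hx2'
        rw [show d + 1 - 1 = d by omega]
        exact this

/-- **Ford's Lemma 2.2 (θ-sandwich constants).** If `0 < δ ≤ 1/10`, `u ≥ 2 − 3δ`,
`R ≥ e⁴⁰` and `δ log R ≥ 1.79` (e.g. `R ≥ 6^{1/δ}`), then
`|𝒞(R^u, R)| ≥ (0.85δ)^w/(w+1)! · R^u/log R`, `w = ⌊u/(1−δ)⌋`.
(Ford: `δ^w/(w+1)!` with Rosser–Schoenfeld's prime sums; the factor `0.85` per level is the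
price of the Chebyshev–Sylvester constants `0.9392/1.0722`.) [cite: Ford2002, Lemma 2.2] -/
theorem card_smoothSet_ge {R δ u : ℝ} (hR : Real.exp 40 ≤ R) (hδ0 : 0 < δ) (hδ : δ ≤ 1 / 10)
    (hδL : 1.79 ≤ δ * Real.log R) (hu : 2 - 3 * δ ≤ u) :
    (0.85 * δ) ^ ⌊u / (1 - δ)⌋₊ / ((⌊u / (1 - δ)⌋₊ + 1).factorial : ℝ) * R ^ u / Real.log R
      ≤ ((smoothSet (R ^ u) R).card : ℝ) := by
  have hR0 : 0 < R := (Real.exp_pos _).trans_le hR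
  have hR1 : 1 < R := by linarith [Real.add_one_le_exp (40 : ℝ)]
  set w := ⌊u / (1 - δ)⌋₊ with hw
  have hδ1 : 0 < 1 - δ := by linarith
  have hw1 : 1 ≤ w := by
    rw [hw]; refine Nat.le_floor ?_
    rw [Nat.cast_one, le_div_iff₀ hδ1]; linarith
  have hd : 2 ≤ w + 1 := by omega
  have hx1 : R ^ (2 - 3 * δ) ≤ R ^ u := Real.rpow_le_rpow_of_exponent_le hR1.le hu
  have hx2 : R ^ u < R ^ (((w + 1 : ℕ) : ℝ) * (1 - δ)) := by
    refine Real.rpow_lt_rpow_of_exponent_lt hR1 ?_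
    have hlt : u / (1 - δ) < (w : ℝ) + 1 := by rw [hw]; exact Nat.lt_floor_add_one _
    rw [div_lt_iff₀ hδ1] at hlt
    push_cast; linarith
  have h := lower_induction hR hδ0 hδ hδL (w + 1) hd (R ^ u) hx1 hx2
  have h2 : ((smoothSetOmega (R ^ u) R (w + 1)).card : ℝ) ≤ ((smoothSet (R ^ u) R).card : ℝ) := by
    exact_mod_cast card_smoothSetOmega_le _ _ _
  refine le_trans ?_ (h.trans h2)
  simp only [Nat.add_sub_cancel]
  rfl


end FordSmooth
end Literature.NumberTheory.LFunctions
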